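import Summits.AnomalousDissipation.AnomalousDissipation.Theorems.SolenoidalFractalHomogenisationRealisedQuasiStaticCellLawOutOfPlaneBlock
import Summits.AnomalousDissipation.AnomalousDissipation.Theorems.SolenoidalFractalHomogenisationLadderFunctionalTridiagonal
import HarnessLib

/-!
# K2R `RealisedQuasiStaticCellLaw`, line `floquet-bloch`: ENHANCED decay of the out-of-plane block of a principal ladder
# during a slot window (helper towards `stub_lowSectorDecay` / `stub_upperSome`; `--supports stmt-AnomalousDissipation-20446`)

Summits-side helper file (everything proved; no definitions, no named facts). First enhanced-rate statement about the
Galerkin truncations of the cell problem: on a time window `[t₀, t₁] ⊆ [0, T]` spent in slot `j`, for a coset `k₀ + ℤK_j`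
whose index segment `W = {J | k₀ + J•K_j ∈ freqBall N}` contains `0, ±1`, whose normalised diagonal
`d_J = |k₀ + J•K_j|²/|K_j|²` satisfies the ladder-functional hypotheses (`d₀ ≤ 1`, `d_J ≥ ½` for `J ≠ 0`, `d_{±1} ≤ 2`), and
whose coupling `g_j(t) = 2π(ê_j·k₀)|a_j|c_j(t)/Λ_j` stays in `[g_lo, g_hi]` (`0 < g_lo ≤ g_hi`) on the window, the
out-of-plane coefficient energy `∑_{J∈W} ‖⟪ζ, α_N(t)(k₀ + J•K_j)⟫‖²` (`ζ ⊥ k₀, K_j`) decays like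
`(5/3)·exp(-(Λ_j·2·g_lo·min(g_lo, g_hi⁻¹)/80)(t - t₀))`, `Λ_j = κ4π²|K_j|²` — uniformly in the truncation order `N`
(`outOfPlane_block_decay`; the gauged ladder of `…OutOfPlaneBlock` fed into ad-prover-2's
`ladderFunctional_decay_intWindow`, STUB-PLAN `stub_lowSectorDecay` §3.3/§3.5).
-/

set_option linter.dupNamespace false

noncomputable section

namespace Summit.AnomalousDissipation.AnomalousDissipation.Theorems.SolenoidalFractalHomogenisation.RealisedQuasiStaticCellLaw

open Set MeasureTheory Filter Topology Function Complex
open scoped InnerProductSpace ComplexConjugate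
open Literature.Analysis Literature.Analysis.FunctionSpaces Literature.Analysis.FunctionSpaces.Torus
open Literature.Analysis.FluidPDE Literature.Analysis.FluidPDE.LatticeShear
open Literature.Analysis.ODE.ThreeTermLadder

variable {k₀ : ℕ}

/-- **Enhanced decay of the out-of-plane block of a principal ladder during a slot window** (uniform in `N`). -/
theorem outOfPlane_block_decay (W : LatticeWord k₀) {n : ℕ} (hn : 0 < n) {κ : ℝ} (hκ : 0 < κ)
    (ℓ : Fin 3 → ℤ) {w₀ : UnitAddTorus (Fin 3) → EuclideanSpace ℝ (Fin 3)}
    (hw₀ : FunctionSpaces.Torus.MemSobolev 1 (FunctionSpaces.EuclideanSpace.complexify ∘ w₀))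
    (hdiv : FunctionSpaces.Torus.IsWeaklyDivFree w₀) (hmean : FunctionSpaces.Torus.HasZeroMean w₀)
    (hsupp : ∀ k : Fin 3 → ℤ, ¬ ((∃ z : Fin 3 → ℤ, k = ℓ + (n:ℤ) • z) ∨ (∃ z : Fin 3 → ℤ, k = -ℓ + (n:ℤ) • z)) →
      UnitAddTorus.mFourierCoeff (FunctionSpaces.EuclideanSpace.complexify ∘ w₀) k = 0)
    {N : ℕ} (hBN : (Finset.univ.biUnion fun j : Fin k₀ =>
        ({(fun i => (W.phase j).m i * n), -(fun i => (W.phase j).m i * n)} : Finset (Fin 3 → ℤ))) ⊆ freqBall N)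
    {T t₀ t₁ : ℝ} (ht₀ : 0 ≤ t₀) (ht₁T : t₁ ≤ T) (j : Fin k₀)
    (hwin : ∀ t ∈ Icc t₀ t₁, Int.fract (t / W.period) * W.period ∈ Icc (W.start j) (W.start j + (W.phase j).τ))
    (k0 : Fin 3 → ℤ) {ζ : EuclideanSpace ℂ (Fin 3)} (hζ₀ : ∑ i, (k0 i : ℂ) * ζ i = 0)
    (hζK : ∑ i, (((fun i => (W.phase j).m i * (n : ℤ)) i : ℤ) : ℂ) * ζ i = 0)
    {Wset : Finset ℤ} (hW : ∀ J : ℤ, J ∈ Wset ↔ k0 + J • (fun i => (W.phase j).m i * (n : ℤ)) ∈ freqBall N)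
    (h0 : (0 : ℤ) ∈ Wset) (h1 : (1 : ℤ) ∈ Wset) (hm1 : (-1 : ℤ) ∈ Wset)
    (hd0 : freqNormSq k0 / freqNormSq (fun i => (W.phase j).m i * (n : ℤ)) ≤ 1)
    (hd : ∀ J ∈ Wset, J ≠ 0 →
      1 / 2 ≤ freqNormSq (k0 + J • (fun i => (W.phase j).m i * (n : ℤ))) / freqNormSq (fun i => (W.phase j).m i * (n : ℤ)))
    (hd1 : freqNormSq (k0 + (1 : ℤ) • (fun i => (W.phase j).m i * (n : ℤ))) /
      freqNormSq (fun i => (W.phase j).m i * (n : ℤ)) ≤ 2)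
    (hdm1 : freqNormSq (k0 + (-1 : ℤ) • (fun i => (W.phase j).m i * (n : ℤ))) /
      freqNormSq (fun i => (W.phase j).m i * (n : ℤ)) ≤ 2)
    {g_lo g_hi : ℝ} (hglo : 0 < g_lo) (hghi : g_lo ≤ g_hi)
    (hg : ∀ t ∈ Ioo t₀ t₁,
      g_lo ≤ 2 * Real.pi * (∑ i, (W.phase j).e i * (k0 i : ℝ)) *
          ‖Complex.exp ((W.phase j).φ * Complex.I) *
            (1 / (2 * ((2 * Real.pi * ‖latticeVec (W.phase j).m‖ : ℝ) : ℂ) * Complex.I))‖ *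
          ((1 / (n : ℝ)) * LatticeWord.trapezoid (W.start j) (W.phase j).τ W.ramp (Int.fract (t / W.period) * W.period)) /
        (κ * (4 * Real.pi ^ 2 * freqNormSq (fun i => (W.phase j).m i * (n : ℤ)))) ∧
      2 * Real.pi * (∑ i, (W.phase j).e i * (k0 i : ℝ)) *
          ‖Complex.exp ((W.phase j).φ * Complex.I) *
            (1 / (2 * ((2 * Real.pi * ‖latticeVec (W.phase j).m‖ : ℝ) : ℂ) * Complex.I))‖ *
          ((1 / (n : ℝ)) * LatticeWord.trapezoid (W.start j) (W.phase j).τ W.ramp (Int.fract (t / W.period) * W.period)) /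
        (κ * (4 * Real.pi ^ 2 * freqNormSq (fun i => (W.phase j).m i * (n : ℤ)))) ≤ g_hi) :
    ∀ t ∈ Icc t₀ t₁,
      ∑ J ∈ Wset, ‖inner ℂ ζ ((pvSetup_cell W hn hκ.le ℓ hw₀ hdiv hmean hsupp).galerkinCoeffAt N t
          (k0 + J • (fun i => (W.phase j).m i * (n : ℤ))))‖ ^ 2 ≤
        5 / 3 * Real.exp (-(κ * (4 * Real.pi ^ 2 * freqNormSq (fun i => (W.phase j).m i * (n : ℤ))) * 2 * g_lo *
            min g_lo g_hi⁻¹ / 80) * (t - t₀)) *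
          ∑ J ∈ Wset, ‖inner ℂ ζ ((pvSetup_cell W hn hκ.le ℓ hw₀ hdiv hmean hsupp).galerkinCoeffAt N t₀
            (k0 + J • (fun i => (W.phase j).m i * (n : ℤ))))‖ ^ 2 := by
  intro t ht
  set hPV := pvSetup_cell W hn hκ.le ℓ hw₀ hdiv hmean hsupp with hPVdef
  set K : Fin 3 → ℤ := fun i => (W.phase j).m i * (n : ℤ) with hK
  have hA0 := layerAmp_ne_zero (W.phase j)
  -- the gauged components on `ℤ`
  set v : ℝ → ℤ → ℂ := fun τ J => (Complex.I * (Complex.exp ((W.phase j).φ * Complex.I) *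
      (1 / (2 * ((2 * Real.pi * ‖latticeVec (W.phase j).m‖ : ℝ) : ℂ) * Complex.I))) /
      (‖Complex.exp ((W.phase j).φ * Complex.I) *
        (1 / (2 * ((2 * Real.pi * ‖latticeVec (W.phase j).m‖ : ℝ) : ℂ) * Complex.I))‖ : ℂ)) ^ (-J) *
    inner ℂ ζ (hPV.galerkinCoeffAt N τ (k0 + J • K)) with hv
  set g : ℝ → ℝ := fun τ => 2 * Real.pi * (∑ i, (W.phase j).e i * (k0 i : ℝ)) *
      ‖Complex.exp ((W.phase j).φ * Complex.I) *
        (1 / (2 * ((2 * Real.pi * ‖latticeVec (W.phase j).m‖ : ℝ) : ℂ) * Complex.I))‖ *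
      ((1 / (n : ℝ)) * LatticeWord.trapezoid (W.start j) (W.phase j).τ W.ramp (Int.fract (τ / W.period) * W.period)) /
    (κ * (4 * Real.pi ^ 2 * freqNormSq K)) with hgdef
  set d : ℤ → ℝ := fun J => freqNormSq (k0 + J • K) / freqNormSq K with hddef
  have hK0 : K ≠ 0 := cellFreq_ne_zero (W.phase j) hn
  have hKpos : 0 < freqNormSq K := by
    obtain ⟨i, hi⟩ : ∃ i, K i ≠ 0 := by
      by_contra h
      push Not at h
      exact hK0 (funext h)
    have hi' : (K i : ℝ) ≠ 0 := by exact_mod_cast hi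
    unfold freqNormSq
    exact lt_of_lt_of_le (by positivity) (Finset.single_le_sum (fun l _ => sq_nonneg ((K l : ℝ))) (Finset.mem_univ i))
  have hΛ : 0 < κ * (4 * Real.pi ^ 2 * freqNormSq K) := by positivity
  -- vanishing off the segment
  have hvsupp : ∀ τ ∈ Icc t₀ t₁, ∀ J, J ∉ Wset → v τ J = 0 := by
    intro τ _ J hJ
    have hnot : k0 + J • K ∉ freqBall N := fun h => hJ ((hW J).2 h)
    simp only [hv]
    rw [Torus.PVSetup.galerkinCoeffAt, coeffExt_of_not_mem _ hnot, inner_zero_right, mul_zero]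
  -- the ladder on the window
  have hderiv : ∀ τ ∈ Icc t₀ t₁, ∀ J ∈ Wset, HasDerivWithinAt (fun τ' => v τ' J)
      (-((κ * (4 * Real.pi ^ 2 * freqNormSq K) : ℝ) : ℂ) * ((d J : ℂ) * v τ J) -
        (g τ : ℂ) * ((κ * (4 * Real.pi ^ 2 * freqNormSq K) : ℝ) : ℂ) *
          ((((fun _ : ℤ => (1 : ℝ)) (J - 1) : ℝ) : ℂ) * v τ (J - 1) - (((fun _ : ℤ => (1 : ℝ)) J : ℝ) : ℂ) * v τ (J + 1)))
      (Icc t₀ t₁) τ := by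
    intro τ hτ J hJ
    have hτT : τ ∈ Icc 0 T := ⟨ht₀.trans hτ.1, hτ.2.trans ht₁T⟩
    have h := hasDerivWithinAt_gauged_outOfPlane W hn hκ ℓ hw₀ hdiv hmean hsupp hBN hτT j (hwin τ hτ) k0 hζ₀ hζK J
      ((hW J).1 hJ)
    refine (h.mono (Icc_subset_Icc ht₀ ht₁T)).congr_deriv ?_
    simp only [hv, hgdef, hddef, hK]
    push_cast
    ring
  have hmain := ladderFunctional_decay_intWindow Wset h0 h1 hm1 d (fun _ => (1 : ℝ))
    (κ * (4 * Real.pi ^ 2 * freqNormSq K)) g_lo g_hi t₀ t₁ g v (fun J _ => by simp) (by norm_num)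
    (div_nonneg (freqNormSq_nonneg _) hKpos.le) (by simpa [hddef] using hd0)
    (fun J hJ hJ0 => by simpa [hddef] using hd J hJ hJ0) (by simpa [hddef] using hd1) (by simpa [hddef] using hdm1)
    hΛ hglo hghi (fun τ hτ => hg τ hτ) hvsupp hderiv t ht
  -- remove the gauge from the energies
  have hE : ∀ τ, ∑ J ∈ Wset, ‖v τ J‖ ^ 2 = ∑ J ∈ Wset, ‖inner ℂ ζ (hPV.galerkinCoeffAt N τ (k0 + J • K))‖ ^ 2 := by
    intro τ
    refine Finset.sum_congr rfl fun J _ => ?_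
    simp only [hv]
    rw [norm_gauge_zpow_mul hA0]
  rw [hE t, hE t₀] at hmain
  have e2 : (1 : ℝ) ^ 2 + (1 : ℝ) ^ 2 = 2 := by norm_num
  rw [e2] at hmain
  convert hmain using 3

end Summit.AnomalousDissipation.AnomalousDissipation.Theorems.SolenoidalFractalHomogenisation.RealisedQuasiStaticCellLaw

end
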